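import Mathlib
import Literature.Computability.AlgebraicComplexity.PermanentIrreducible

/-!
# Crux `WordLengthQP` (stmt-ValiantsHypothesis-6623), line `Sketch` (eps-order-ladder) — stub `stub_perPatternIrred`

Zero-pattern version of von zur Gathen 1987, Thm. 3.4 (the permanent is irreducible; tree theorem
`perPoly_irreducible`).  For a set `Z` of cells of an `n × n` matrix with `|Z| + 2 ≤ n`:
(a) some permutation `ρ` avoids `Z` (`(ρ i, i) ∉ Z` for all `i`; Hall's marriage theorem plus a
count), and (b) the permanent of the zero pattern `P_Z = ∑_{ρ avoiding Z} X^{μ_ρ}` is not a product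
of two polynomials of positive total degree.  The proof of (b) follows the tree's
`vars_factor_perPoly_trivial`: hybrid monomials `X^{μ_π|S} X^{μ_π'|Sᶜ}` of avoiding permutation
monomials are again avoiding permutation monomials, so the set `S` of variables of one factor is
closed along the `Z`-free cells of rows and columns; a `Z`-free column then connects everything.
-/

-- `Summit.ValiantsHypothesis.ValiantsHypothesis.…` is the tree's mandated single-conjunct layout
-- (Sub = Summit), so the duplicated namespace component is intended.
set_option linter.dupNamespace false

noncomputable section

open MvPolynomial

namespace Summit.ValiantsHypothesis.ValiantsHypothesis.Cruxes.WordLengthQP.EpsOrderLadder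

open Literature.Computability.AlgebraicComplexity

/-! ### Avoiding permutations (Hall-type counting) -/

/-- If `Z` has fewer than `card α = card β` cells, some bijection `e : α ≃ β` avoids `Z`:
`(e x, x) ∉ Z` for all `x` (Hall's marriage theorem; the Hall condition holds because a deficient
set `s` of size `k` would give `(m - |N(s)|) · k ≥ (m - k + 1) · k ≥ m > |Z|` cells of `Z`).
[folklore] -/
theorem perPattern_exists_equiv_avoid {α β : Type*} [Fintype α] [Fintype β] [DecidableEq β]
    (Z : Finset (β × α)) (hcard : Fintype.card α = Fintype.card β)
    (hZ : Z.card < Fintype.card α) : ∃ e : α ≃ β, ∀ x, (e x, x) ∉ Z := by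
  classical
  have hall : ∀ s : Finset α,
      s.card ≤ (s.biUnion fun x => Finset.univ.filter fun y => (y, x) ∉ Z).card := by
    intro s
    by_contra hlt
    rw [not_le] at hlt
    set U : Finset β := s.biUnion fun x => Finset.univ.filter fun y => (y, x) ∉ Z with hU
    -- all cells in `Uᶜ × s` belong to `Z`
    have hsub : Uᶜ ×ˢ s ⊆ Z := by
      rintro ⟨y, x⟩ hp
      obtain ⟨hy, hx⟩ := Finset.mem_product.1 hp
      rw [Finset.mem_compl] at hy
      by_contra hpZ
      refine hy ?_
      rw [hU, Finset.mem_biUnion]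
      exact ⟨x, hx, Finset.mem_filter.2 ⟨Finset.mem_univ _, hpZ⟩⟩
    have h1 : (Fintype.card β - U.card) * s.card ≤ Z.card := by
      rw [← Finset.card_compl, ← Finset.card_product]
      exact Finset.card_le_card hsub
    have h3 : s.card ≤ Fintype.card α := Finset.card_le_univ s
    have key : Fintype.card α ≤ (Fintype.card β - U.card) * s.card := by
      rw [← hcard]
      obtain ⟨a, ha⟩ := Nat.exists_eq_add_of_lt hlt
      obtain ⟨d, hd⟩ := Nat.exists_eq_add_of_le h3
      rw [hd, ha, show U.card + a + 1 + d - U.card = a + 1 + d by omega]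
      nlinarith
    exact absurd (lt_of_le_of_lt (key.trans h1) hZ) (lt_irrefl _)
  obtain ⟨f, hf, hfZ⟩ := (Finset.all_card_le_biUnion_card_iff_exists_injective _).1 hall
  have hbij : Function.Bijective f :=
    (Fintype.bijective_iff_injective_and_card f).2 ⟨hf, hcard⟩
  exact ⟨Equiv.ofBijective f hbij, fun x => (Finset.mem_filter.1 (hfZ x)).2⟩

/-- Some permutation avoids a pattern `Z` of fewer than `n` cells. [folklore] -/
theorem perPattern_exists_perm_avoid (n : ℕ) (Z : Finset (Fin n × Fin n)) (hZ : Z.card < n) :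
    ∃ ρ : Equiv.Perm (Fin n), ∀ i, (ρ i, i) ∉ Z :=
  perPattern_exists_equiv_avoid Z rfl (by rwa [Fintype.card_fin])

/-- A permutation fixing `c` and avoiding a pattern `W ∌ (c, c)` with `|W| + 2 ≤ n` exists.
[folklore] -/
theorem perPattern_exists_perm_fix (n : ℕ) (c : Fin n) (W : Finset (Fin n × Fin n))
    (hW : W.card + 2 ≤ n) (hc : (c, c) ∉ W) :
    ∃ σ : Equiv.Perm (Fin n), σ c = c ∧ ∀ i, (σ i, i) ∉ W := by
  classical
  -- restrict the pattern to the indices different from `c`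
  set W' : Finset ({x : Fin n // x ≠ c} × {x : Fin n // x ≠ c}) :=
    Finset.univ.filter fun p => ((p.1 : Fin n), (p.2 : Fin n)) ∈ W with hW'
  have hcardW' : W'.card ≤ W.card := by
    refine Finset.card_le_card_of_injOn (fun p => ((p.1 : Fin n), (p.2 : Fin n))) ?_ ?_
    · intro p hp
      exact (Finset.mem_filter.1 (Finset.mem_coe.1 hp)).2
    · intro p _ q _ hpq
      simp only [Prod.mk.injEq] at hpq
      exact Prod.ext (Subtype.ext hpq.1) (Subtype.ext hpq.2)
  have hcardα : Fintype.card {x : Fin n // x ≠ c} = n - 1 := by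
    rw [Fintype.card_subtype_compl, Fintype.card_fin, Fintype.card_subtype_eq]
  obtain ⟨e, he⟩ := perPattern_exists_equiv_avoid W' rfl (by rw [hcardα]; omega)
  have hcc : ¬ (c ≠ c) := fun h => h rfl
  refine ⟨Equiv.Perm.ofSubtype e, Equiv.Perm.ofSubtype_apply_of_not_mem e hcc, fun i => ?_⟩
  by_cases hi : i = c
  · rw [hi, Equiv.Perm.ofSubtype_apply_of_not_mem e hcc]
    exact hc
  · rw [Equiv.Perm.ofSubtype_apply_of_mem e hi]
    intro hmem
    refine he ⟨i, hi⟩ ?_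
    rw [hW', Finset.mem_filter]
    exact ⟨Finset.mem_univ _, hmem⟩

/-- Through every `Z`-free cell `(r, c)` of a pattern with `|Z| + 2 ≤ n` passes a permutation
avoiding `Z`. [folklore] -/
theorem perPattern_exists_perm_through (n : ℕ) (Z : Finset (Fin n × Fin n))
    (hZ : Z.card + 2 ≤ n) (r c : Fin n) (hrc : (r, c) ∉ Z) :
    ∃ ρ : Equiv.Perm (Fin n), ρ c = r ∧ ∀ i, (ρ i, i) ∉ Z := by
  classical
  -- relabel the rows by the transposition `(r c)`, reducing to a permutation fixing `c`
  set W : Finset (Fin n × Fin n) := Z.image fun p => (Equiv.swap r c p.1, p.2) with hW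
  have hWcard : W.card + 2 ≤ n := le_trans (Nat.add_le_add_right Finset.card_image_le 2) hZ
  have hcc : (c, c) ∉ W := by
    rw [hW, Finset.mem_image]
    rintro ⟨⟨y, x⟩, hp, hpc⟩
    simp only [Prod.mk.injEq] at hpc
    obtain ⟨hyc, hxc⟩ := hpc
    have hy : y = r :=
      (Equiv.swap r c).injective (hyc.trans (Equiv.swap_apply_left r c).symm)
    rw [hy, hxc] at hp
    exact hrc hp
  obtain ⟨σ, hσc, hσ⟩ := perPattern_exists_perm_fix n c W hWcard hcc
  refine ⟨σ.trans (Equiv.swap r c), ?_, fun i hi => ?_⟩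
  · rw [Equiv.trans_apply, hσc, Equiv.swap_apply_right]
  · refine hσ i ?_
    rw [hW, Finset.mem_image]
    exact ⟨_, hi, by simp⟩

/-- If `|Z| < n`, some column is `Z`-free. [folklore] -/
theorem perPattern_exists_col (n : ℕ) (Z : Finset (Fin n × Fin n)) (hZ : Z.card < n) :
    ∃ c, ∀ r, (r, c) ∉ Z := by
  have hlt : (Z.image Prod.snd).card < (Finset.univ : Finset (Fin n)).card := by
    rw [Finset.card_univ, Fintype.card_fin]
    exact Finset.card_image_le.trans_lt hZ
  obtain ⟨c, -, hc⟩ := Finset.exists_mem_notMem_of_card_lt_card hlt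
  exact ⟨c, fun r hr => hc (Finset.mem_image_of_mem Prod.snd hr)⟩

/-! ### The permanent of a zero pattern: coefficients and degrees -/

/-- Coefficients of the pattern permanent `P_Z = ∑_{ρ avoiding Z} X^{μ_ρ}`. [folklore] -/
theorem perPattern_coeff {R : Type*} [CommSemiring R] (n : ℕ) (Z : Finset (Fin n × Fin n))
    (d : (Fin n × Fin n) →₀ ℕ) :
    coeff d (∑ ρ ∈ (Finset.univ : Finset (Equiv.Perm (Fin n))).filter
        (fun ρ => ∀ i, (ρ i, i) ∉ Z), monomial (permMonomial ρ) (1 : R)) =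
      ∑ ρ ∈ (Finset.univ : Finset (Equiv.Perm (Fin n))).filter (fun ρ => ∀ i, (ρ i, i) ∉ Z),
        if permMonomial ρ = d then (1 : R) else 0 := by
  rw [coeff_sum]
  simp only [coeff_monomial]

/-- An avoiding permutation monomial has coefficient `1` in `P_Z`. [folklore] -/
theorem perPattern_coeff_permMonomial {R : Type*} [CommSemiring R] (n : ℕ)
    (Z : Finset (Fin n × Fin n)) (ρ : Equiv.Perm (Fin n)) (hρ : ∀ i, (ρ i, i) ∉ Z) :
    coeff (permMonomial ρ) (∑ π ∈ (Finset.univ : Finset (Equiv.Perm (Fin n))).filter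
        (fun π => ∀ i, (π i, i) ∉ Z), monomial (permMonomial π) (1 : R)) = 1 := by
  rw [perPattern_coeff, Finset.sum_eq_single ρ]
  · simp
  · intro π _ hπ
    simp [permMonomial_injective.ne hπ]
  · intro h
    exact absurd (Finset.mem_filter.2 ⟨Finset.mem_univ _, hρ⟩) h

/-- The support of `P_Z` consists of avoiding permutation monomials. [folklore] -/
theorem perPattern_exists_of_coeff_ne_zero {R : Type*} [CommSemiring R] (n : ℕ)
    (Z : Finset (Fin n × Fin n)) {d : (Fin n × Fin n) →₀ ℕ}
    (h : coeff d (∑ π ∈ (Finset.univ : Finset (Equiv.Perm (Fin n))).filter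
        (fun π => ∀ i, (π i, i) ∉ Z), monomial (permMonomial π) (1 : R)) ≠ 0) :
    ∃ ρ : Equiv.Perm (Fin n), (∀ i, (ρ i, i) ∉ Z) ∧ permMonomial ρ = d := by
  by_contra hne
  apply h
  rw [perPattern_coeff]
  exact Finset.sum_eq_zero fun ρ hρ => if_neg fun hd => hne ⟨ρ, (Finset.mem_filter.1 hρ).2, hd⟩

/-- `P_Z` is multilinear: every variable has degree `≤ 1`. [folklore] -/
theorem perPattern_degreeOf_le_one {R : Type*} [CommSemiring R] (n : ℕ)
    (Z : Finset (Fin n × Fin n)) (v : Fin n × Fin n) :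
    degreeOf v (∑ π ∈ (Finset.univ : Finset (Equiv.Perm (Fin n))).filter
        (fun π => ∀ i, (π i, i) ∉ Z), monomial (permMonomial π) (1 : R)) ≤ 1 := by
  rw [degreeOf_le_iff]
  intro d hd
  obtain ⟨ρ, -, rfl⟩ := perPattern_exists_of_coeff_ne_zero n Z (mem_support_iff.1 hd)
  obtain ⟨r, c⟩ := v
  rw [permMonomial_apply]
  split_ifs <;> simp

/-- The cells of the pattern `Z` do not occur in `P_Z`. [folklore] -/
theorem perPattern_degreeOf_eq_zero {R : Type*} [CommSemiring R] (n : ℕ)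
    (Z : Finset (Fin n × Fin n)) (v : Fin n × Fin n) (hv : v ∈ Z) :
    degreeOf v (∑ π ∈ (Finset.univ : Finset (Equiv.Perm (Fin n))).filter
        (fun π => ∀ i, (π i, i) ∉ Z), monomial (permMonomial π) (1 : R)) = 0 := by
  apply Nat.eq_zero_of_le_zero
  rw [degreeOf_le_iff]
  intro d hd
  obtain ⟨ρ, hρ, rfl⟩ := perPattern_exists_of_coeff_ne_zero n Z (mem_support_iff.1 hd)
  obtain ⟨r, c⟩ := v
  rw [permMonomial_apply, if_neg]
  intro h
  apply hρ c
  rwa [h]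

/-! ### Non-factorability of the permanent of a zero pattern -/

/-- Key step (zero-pattern version of von zur Gathen 1987, Thm. 3.4, following the tree's
`vars_factor_perPoly_trivial`): if `g h = P_Z` with `|Z| + 2 ≤ n`, then `g` or `h` has no
variables. [folklore] -/
theorem perPattern_factor {R : Type*} [CommRing R] [IsDomain R] (n : ℕ)
    (Z : Finset (Fin n × Fin n)) (hZ : Z.card + 2 ≤ n) {g h : MvPolynomial (Fin n × Fin n) R}
    (hgh : g * h = ∑ ρ ∈ (Finset.univ : Finset (Equiv.Perm (Fin n))).filter
        (fun ρ => ∀ i, (ρ i, i) ∉ Z), monomial (permMonomial ρ) (1 : R)) :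
    (∀ d ∈ g.support, d = 0) ∨ (∀ d ∈ h.support, d = 0) := by
  classical
  obtain ⟨ρ₀, hρ₀⟩ := perPattern_exists_perm_avoid n Z (by omega)
  have hne : g * h ≠ 0 := by
    rw [hgh]
    intro h0
    have := perPattern_coeff_permMonomial (R := R) n Z ρ₀ hρ₀
    rw [h0, coeff_zero] at this
    exact zero_ne_one this
  have hg0 : g ≠ 0 := left_ne_zero_of_mul hne
  have hh0 : h ≠ 0 := right_ne_zero_of_mul hne
  -- the variables split between `g` and `h`, and the `Z`-cells occur in neither
  have hdeg : ∀ v, degreeOf v g + degreeOf v h ≤ 1 := fun v => by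
    rw [← degreeOf_mul_eq hg0 hh0, hgh]
    exact perPattern_degreeOf_le_one n Z v
  have hdegZ : ∀ v ∈ Z, degreeOf v g + degreeOf v h = 0 := fun v hv => by
    rw [← degreeOf_mul_eq hg0 hh0, hgh]
    exact perPattern_degreeOf_eq_zero n Z v hv
  set S : Finset (Fin n × Fin n) := Finset.univ.filter fun v => degreeOf v g ≠ 0 with hS
  have hgS : ∀ d ∈ g.support, ∀ v, d v ≠ 0 → v ∈ S := fun d hd v hv => by
    rw [hS, Finset.mem_filter]
    refine ⟨Finset.mem_univ _, fun h0 => hv ?_⟩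
    have := monomial_le_degreeOf v hd
    omega
  have hhS : ∀ d ∈ h.support, ∀ v, d v ≠ 0 → v ∉ S := fun d hd v hv hvS => by
    rw [hS, Finset.mem_filter] at hvS
    have h1 := monomial_le_degreeOf v hd
    have h2 := hdeg v
    omega
  have hSZ : ∀ v ∈ S, v ∉ Z := fun v hvS hvZ => by
    rw [hS, Finset.mem_filter] at hvS
    have := hdegZ v hvZ
    omega
  -- (F1) every avoiding permutation monomial splits into a `g`-part and an `h`-part
  have F1 : ∀ π : Equiv.Perm (Fin n), (∀ i, (π i, i) ∉ Z) →
      coeff ((permMonomial π).filter (· ∈ S)) g *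
        coeff ((permMonomial π).filter (¬ · ∈ S)) h = 1 := fun π hπ => by
    rw [← coeff_mul_of_separated S hgS hhS, hgh, perPattern_coeff_permMonomial n Z π hπ]
  -- (F2) hybrids of avoiding permutation monomials are avoiding permutation monomials
  have F2 : ∀ π π' : Equiv.Perm (Fin n), (∀ i, (π i, i) ∉ Z) → (∀ i, (π' i, i) ∉ Z) →
      ∃ ρ : Equiv.Perm (Fin n), (∀ i, (ρ i, i) ∉ Z) ∧ permMonomial ρ =
        (permMonomial π).filter (· ∈ S) + (permMonomial π').filter (¬ · ∈ S) := by
    intro π π' hπ hπ'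
    set ν := (permMonomial π).filter (· ∈ S) + (permMonomial π').filter (¬ · ∈ S) with hν
    have e1 : ν.filter (· ∈ S) = (permMonomial π).filter (· ∈ S) := by
      ext v
      simp only [hν, Finsupp.filter_apply, Finsupp.add_apply]
      by_cases hv : v ∈ S <;> simp [hv]
    have e2 : ν.filter (¬ · ∈ S) = (permMonomial π').filter (¬ · ∈ S) := by
      ext v
      simp only [hν, Finsupp.filter_apply, Finsupp.add_apply]
      by_cases hv : v ∈ S <;> simp [hv]
    have hcoeff : coeff ν (g * h) ≠ 0 := by
      rw [coeff_mul_of_separated S hgS hhS, e1, e2]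
      have a := F1 π hπ
      have b := F1 π' hπ'
      exact mul_ne_zero (left_ne_zero_of_mul (a.symm ▸ one_ne_zero))
        (right_ne_zero_of_mul (b.symm ▸ one_ne_zero))
    rw [hgh] at hcoeff
    exact perPattern_exists_of_coeff_ne_zero n Z hcoeff
  -- (F3) rows: `S` is closed along the `Z`-free cells of a row
  have F3 : ∀ r b b', (r, b) ∈ S → (r, b') ∉ Z → (r, b') ∈ S := by
    intro r b b' hrb hrb'
    obtain ⟨π, hπb, hπ⟩ := perPattern_exists_perm_through n Z hZ r b (hSZ _ hrb)
    obtain ⟨π', hπb', hπ'⟩ := perPattern_exists_perm_through n Z hZ r b' hrb'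
    obtain ⟨ρ, -, hρ⟩ := F2 π π' hπ hπ'
    have hsy : π.symm r = b := by rw [Equiv.symm_apply_eq]; exact hπb.symm
    have hsy' : π'.symm r = b' := by rw [Equiv.symm_apply_eq]; exact hπb'.symm
    have := rowCount_permMonomial ρ r
    rw [hρ, rowCount_add, rowCount_filter_permMonomial, rowCount_filter_permMonomial, hsy, hsy',
      if_pos hrb] at this
    by_contra hb'
    rw [if_pos hb'] at this
    omega
  -- (F4) columns: `S` is closed along the `Z`-free cells of a column
  have F4 : ∀ c a a', (a, c) ∈ S → (a', c) ∉ Z → (a', c) ∈ S := by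
    intro c a a' hac ha'c
    obtain ⟨π, hπc, hπ⟩ := perPattern_exists_perm_through n Z hZ a c (hSZ _ hac)
    obtain ⟨π', hπc', hπ'⟩ := perPattern_exists_perm_through n Z hZ a' c ha'c
    obtain ⟨ρ, -, hρ⟩ := F2 π π' hπ hπ'
    have := colCount_permMonomial ρ c
    rw [hρ, colCount_add, colCount_filter_permMonomial, colCount_filter_permMonomial, hπc, hπc',
      if_pos hac] at this
    by_contra ha'
    rw [if_pos ha'] at this
    omega
  -- connectivity through a `Z`-free column: `S = ∅` or `h` has no variables
  by_cases hSne : S.Nonempty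
  · right
    obtain ⟨⟨a, b⟩, hab⟩ := hSne
    obtain ⟨c₀, hc₀⟩ := perPattern_exists_col n Z (by omega)
    intro d hd
    ext ⟨i, j⟩
    rw [Finsupp.coe_zero, Pi.zero_apply]
    by_contra hv
    have hijS : (i, j) ∉ S := hhS d hd (i, j) hv
    have hijZ : (i, j) ∉ Z := fun hijZ => by
      have h1 := monomial_le_degreeOf (i, j) hd
      have h2 := hdegZ _ hijZ
      omega
    exact hijS (F3 i c₀ j (F4 c₀ a i (F3 a b c₀ hab (hc₀ a)) (hc₀ i)) hijZ)
  · left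
    intro d hd
    ext v
    rw [Finsupp.coe_zero, Pi.zero_apply]
    by_contra hv
    exact hSne ⟨v, hgS d hd v hv⟩

/-- **stub_perPatternIrred** (von zur Gathen 1987 Thm 3.4-type, zero patterns): if `|Z| + 2 ≤ n`
then some permutation avoids `Z`, and the permanent of the zero pattern `Z` is not a product of two
polynomials of positive degree. -/
theorem stub_perPatternIrred (n : ℕ) (Z : Finset (Fin n × Fin n)) (hZ : Z.card + 2 ≤ n) :
    (∃ ρ : Equiv.Perm (Fin n), ∀ i, (ρ i, i) ∉ Z) ∧
    ∀ g h : MvPolynomial (Fin n × Fin n) ℂ,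
      g * h = ∑ ρ ∈ (Finset.univ : Finset (Equiv.Perm (Fin n))).filter (fun ρ => ∀ i, (ρ i, i) ∉ Z),
          MvPolynomial.monomial (Literature.Computability.AlgebraicComplexity.permMonomial ρ)
            (1 : ℂ) →
      g.totalDegree = 0 ∨ h.totalDegree = 0 := by
  refine ⟨perPattern_exists_perm_avoid n Z (by omega), fun g h hgh => ?_⟩
  rcases perPattern_factor n Z hZ hgh with hg | hh
  · left
    rw [eq_C_of_support_subset_zero hg, totalDegree_C]
  · right
    rw [eq_C_of_support_subset_zero hh, totalDegree_C]

end Summit.ValiantsHypothesis.ValiantsHypothesis.Cruxes.WordLengthQP.EpsOrderLadder
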